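import Summits.BirchSwinnertonDyer.BirchSwinnertonDyer.Theses.ByReductionTypeAtTwo
import Summits.BirchSwinnertonDyer.BirchSwinnertonDyer.Theorems.ByReductionTypeAtTwoMultLowerHalfIso
import Summits.BirchSwinnertonDyer.BirchSwinnertonDyer.Theorems.ByReductionTypeAtTwoMultUpperHalfDefs
import HarnessLib

/-!
# Line `two-halves` — skeleton for crux `MultLowerHalfAtTwo`
# (item stmt-BirchSwinnertonDyer-19923, route ByReductionTypeAtTwo, rung K4, rank 303; lane `bsd-2adic-mult-3`)

The crux (`ord₂ #Ш_an ≤ ord₂ #Ш[2^∞]` for every non-CM `E/ℚ` of analytic rank `0` MULTIPLICATIVE at `2`;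
1 969 rank-0 book230 classes) from FOUR stubs, composed by the LANDED isogeny-hedged bridge of mult-3 GEN 5
(`Theorems.multLowerHalfAtTwo_of_multEisensteinIso_bySign`, file `…MultLowerHalfIso.lean`; per-pair chain
p432673 `…_of_thm15` (conv-2 GEN 4) ∘ ord-3's `EisensteinShaCurrency.missingLowerBoundAt_two_of_isIsogenous`;
typed object p417443 `X5.O1.MultEisensteinDivisibilityAtTwo` (T-mult-4-int, mult-3 GEN 0)). Planner
bsd-2adic-plan GEN 13 (cell INBOX 2026-08-26T09:15:50Z (b)): the lower half gets a LINE like 19922's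
`four_roads`, so that its WALL is a REGISTERED stub a disprover / strategist can be seated against.

* `stub_pub` — PUBLISHED ×6 (closed by citation): Greenberg's Thm-4.1 analogues at a multiplicative prime
  (non-split GUARDED twin `…_anyPrime_oddLocalDegree`, audit N-1 / D-AUDIT h41, never A235; split base change
  A236), modular parametrisation (BCDT), Gross–Zagier–Kolyvagin, Greenberg's Thm. 1.5 (Kato–Rohrlich:
  `X(E/ℚ_∞)` is `Λ`-torsion at a multiplicative `p`, p431724), Cassels' isogeny invariance of the BSD quotient.
* `stub_gsSplit` — MEMO: Greenberg–Stevens at a split multiplicative `2` (mult/PROOF-GS2.md, RC-4 PASS; the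
  SAME constant `MultUpperHalvesAtTwo.GreenbergStevensAtSplitTwo` as line `four_roads` of 19922 — one
  discharge serves both lines). Needed by the split half only.
* `stub_eisNonsplit` — WALL (research; not in print at `p = 2`): for every non-CM `E/ℚ` of analytic rank `0`
  with NON-SPLIT multiplicative reduction at `2`, SOME `ℚ`-isogenous globally minimal `W'` multiplicative at
  `2` satisfies the integral Eisenstein direction of the `2`-adic main conjecture
  `X5.O1.MultEisensteinDivisibilityAtTwo W'` (`ϖ·L₂(f,−1) ∣ f_X` in `ℤ₂⟦T⟧`, Néron normalisation at `W'`;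
  ordinary type, no trivial zero; its road to the crux is PRINT-only after Thm. 1.5).
* `stub_eisSplit` — WALL (research): the same with SPLIT multiplicative reduction at `2`
  (`ϖ·L₂(f,1) ∣ T·f_X`: the trivial zero charged to `T`; its road carries the MEMO stub).
Both WALL stubs are the ISOGENY-HEDGED ((β), director pattern 19271 → 19573) and rank-`0`, sign-split
restrictions of ONE research object — conv-2's `stub_multEisensteinIso` of line `cycint` on crux 19187
(S3ᵐ) — which implies both (`Theorems.multEisensteinIso_bySign_of_multEisensteinIso`); the member-wise
object of GEN 0–4 implies them too (`Theorems.multEisensteinIso_bySign_of_memberwise`). The crux itself is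
an isogeny-CLASS statement (`Theorems.multLowerHalfAtTwo_iff_upToIsogeny`), so the hedge loses nothing.
Census (mult-3 GEN 2, evidence on the item): per class the crux is DECIDED by descent records on
1 965 / 1 969 rank-0 classes WITHOUT either WALL; the residue is 4 K = 4 singletons (172042o, 219558q,
349522b, 412830t: all a₂ = −1, i.e. under `stub_eisNonsplit`) = Cassels–Tate on `Sel₈` (no engine).
-/

set_option autoImplicit false
-- the Cruxes namespace of this sub repeats the summit name by design (D-0017 nested layout)
set_option linter.dupNamespace false

noncomputable section

open scoped Classical

open WeierstrassCurve Literature.NumberTheory.EllipticCurves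
  Literature.NumberTheory.EllipticCurves.ModularForms
  Literature.NumberTheory.EllipticCurves.Greenberg1999
  Literature.NumberTheory.EllipticCurves.Rank1Residual
  Literature.NumberTheory.EllipticCurves.Rank1Residual.Typed
  Summit.BirchSwinnertonDyer.Rank1Residual.X5
  Summit.BirchSwinnertonDyer.BirchSwinnertonDyer.Theorems

namespace Summit.BirchSwinnertonDyer.BirchSwinnertonDyer.Cruxes.MultLowerHalfAtTwo

namespace TwoHalves

/-- stub (1): the six PUBLISHED inputs (closed by citation; the Thm-4.1 non-split analogue in its GUARDED form).
[cite: GreenbergLNM1716, §4 pp. 112–113 and Thm. 1.5 (p. 61)] [cite: BCDTJAMS2001, Thm. A]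
[cite: Cassels1965ArithmeticVIII, Thm. 1.1] -/
theorem stub_pub :
    thm41Analogue_charValue_rankZero_numberField_anyPrime_oddLocalDegree ∧
      thm41Analogue_charValue_rankZero_split_baseChange_anyPrime ∧
      nonempty_modularParametrizationData ∧ rank_eq_analyticRank_of_analyticRank_le_one ∧
      thm15_isTorsion_multiplicative_rat ∧ bsdRHS_eq_of_isIsogenous := by
  sorry

/-- stub (2): MEMO — Greenberg–Stevens at a split multiplicative `2` (same constant as line `four_roads` of 19922).
[cite: GreenbergStevens1993, Theorem of the Introduction (shape; p odd in print)] -/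
theorem stub_gsSplit : MultUpperHalvesAtTwo.GreenbergStevensAtSplitTwo := by
  sorry

/-- stub (3): WALL — the integral Eisenstein direction of the `2`-adic main conjecture at SOME isogenous globally
minimal member, for every non-CM rank-`0` curve with NON-SPLIT multiplicative reduction at `2` (T-mult-4-int,
isogeny-hedged; not in print at `p = 2`). [cite: Skinner2016PacificMC, Thm. A and Thm. B (shape; p ≥ 3)]
[cite: SkinnerUrban2014, Thm. 3.6.4 (p. 43; p odd; shape)] -/
theorem stub_eisNonsplit :
    ∀ (W : WeierstrassCurve ℚ) [W.IsElliptic] [W.IsGloballyMinimal], ¬ W.HasCM →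
      W.analyticRank = 0 → Mult W 2 → ¬ W.HasSplitMultiplicativeReductionAtPrime 2 →
        ∃ (W' : WeierstrassCurve ℚ) (_ : W'.IsElliptic) (_ : W'.IsGloballyMinimal),
          IsIsogenous W W' ∧ Mult W' 2 ∧ O1.MultEisensteinDivisibilityAtTwo W' := by
  sorry

/-- stub (4): WALL — the same for SPLIT multiplicative reduction at `2` (trivial zero charged to `T`).
[cite: Skinner2016PacificMC, Thm. A and Thm. B (shape; p ≥ 3)] [cite: GreenbergLNM1716, §4 pp. 112–113] -/
theorem stub_eisSplit :
    ∀ (W : WeierstrassCurve ℚ) [W.IsElliptic] [W.IsGloballyMinimal], ¬ W.HasCM →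
      W.analyticRank = 0 → Mult W 2 → W.HasSplitMultiplicativeReductionAtPrime 2 →
        ∃ (W' : WeierstrassCurve ℚ) (_ : W'.IsElliptic) (_ : W'.IsGloballyMinimal),
          IsIsogenous W W' ∧ Mult W' 2 ∧ O1.MultEisensteinDivisibilityAtTwo W' := by
  sorry

/-- composition = THE SKELETON: the crux BY NAME from exactly the four registered stubs, by the landed
isogeny-hedged bridge `Theorems.multLowerHalfAtTwo_of_multEisensteinIso_bySign` (mult-3 GEN 5, p437198): PRINT ×6 →
MEMO `GreenbergStevensAtSplitTwo` → WALL non-split → WALL split → `MultLowerHalfAtTwo`. Kernel-checked, no sorry of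
its own (what `ledger skeleton check` composes). [cite: GreenbergLNM1716, Thm. 1.5 (p. 61) and §4 pp. 112–113]
[cite: Cassels1965ArithmeticVIII, Thm. 1.1] -/
theorem MultLowerHalfAtTwo_of :
    Summit.BirchSwinnertonDyer.BirchSwinnertonDyer.Theses.ByReductionTypeAtTwo.MultLowerHalfAtTwo :=
  multLowerHalfAtTwo_of_multEisensteinIso_bySign stub_pub.1 stub_pub.2.1 stub_pub.2.2.1 stub_pub.2.2.2.1
    stub_pub.2.2.2.2.1 stub_pub.2.2.2.2.2 stub_gsSplit stub_eisNonsplit stub_eisSplit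

end TwoHalves

end Summit.BirchSwinnertonDyer.BirchSwinnertonDyer.Cruxes.MultLowerHalfAtTwo

end
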